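import Mathlib

/-!
# Angular Paley–Wiener for `π/2`-periodic entire functions of exponential type
(candidate proof of `stub_bandlimit` of line `complex-rotation-bandlimit`, crux stmt-QuantumFields-11686;
drefute seat — positive lemma, evidence only)

`Φ` entire, `Φ (z + π/2) = Φ z`, `‖Φ z‖ ≤ C e^{N |Im z|}`, `N < 4 (K + 1)`
  ⟹ `Φ θ = ∑_{|k| ≤ K} c_k e^{4ikθ}` on `ℝ`, with `c_k` the Fourier coefficients on `AddCircle (π/2)`.
Route: contour shift on the rectangle `[0, π/2] × [0, y]` (vertical sides cancel by periodicity) gives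
`∫₀^{π/2} e^{-4ikx} Φ(x) dx = ∫₀^{π/2} e^{-4ik(x+iy)} Φ(x+iy) dx` for every real `y`; the bound
`≤ (π/2)·C·e^{N|y| + 4ky}` tends to `0` as `y → ∓∞` when `4|k| > N`; so the Fourier coefficients vanish for
`|k| ≥ K + 1`, the Fourier series is a finite sum, and Mathlib's pointwise Fourier inversion
(`has_pointwise_sum_fourier_series_of_summable`) identifies it with `Φ` on `ℝ`.
-/

noncomputable section

open Complex MeasureTheory Filter Topology intervalIntegral
open scoped Real

namespace AngularPaleyWiener

/-- Contour shift: for an entire `T`-periodic `g`, `∫₀^T g(x + iy) dx` does not depend on `y`. -/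
theorem integral_shift_eq (g : ℂ → ℂ) (hg : Differentiable ℂ g) (T : ℝ) (hgT : ∀ z : ℂ, g (z + T) = g z)
    (y : ℝ) : ∫ x in (0 : ℝ)..T, g (x + y * I) = ∫ x in (0 : ℝ)..T, g x := by
  have h := Complex.integral_boundary_rect_eq_zero_of_differentiableOn g 0 (T + y * I) hg.differentiableOn
  simp only [zero_re, zero_im, add_re, ofReal_re, mul_re, I_re, mul_zero, ofReal_im, I_im, mul_one,
    sub_self, add_zero, add_im, mul_im, zero_add, ofReal_zero, zero_mul] at h
  -- the two vertical sides agree by periodicity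
  have hvert : (∫ t in (0 : ℝ)..y, g (↑T + ↑t * I)) = ∫ t in (0 : ℝ)..y, g (↑t * I) := by
    refine intervalIntegral.integral_congr fun t _ => ?_
    rw [add_comm, hgT]
  rw [hvert] at h
  have h' : (∫ x in (0 : ℝ)..T, g ↑x) - ∫ x in (0 : ℝ)..T, g (↑x + ↑y * I) = 0 := by
    linear_combination h
  exact (sub_eq_zero.1 h').symm

/-- The twisted function `g_k(z) = e^{-4ikz} Φ(z)`. -/
def gk (Φ : ℂ → ℂ) (k : ℤ) (z : ℂ) : ℂ := Complex.exp (-(4 * (k : ℂ) * z * I)) * Φ z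

theorem gk_differentiable {Φ : ℂ → ℂ} (hΦ : Differentiable ℂ Φ) (k : ℤ) : Differentiable ℂ (gk Φ k) := by
  unfold gk
  fun_prop

/-- `e^{-4ik(π/2)} = 1`. -/
theorem exp_neg_four_k_half_pi (k : ℤ) : Complex.exp (-(4 * (k : ℂ) * (Real.pi / 2 : ℝ) * I)) = 1 := by
  have : -(4 * (k : ℂ) * (Real.pi / 2 : ℝ) * I) = ((-k : ℤ) : ℂ) * (2 * Real.pi * I) := by
    push_cast; ring
  rw [this]
  exact Complex.exp_int_mul_two_pi_mul_I (-k)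

theorem gk_periodic {Φ : ℂ → ℂ} (hper : ∀ z : ℂ, Φ (z + (Real.pi / 2 : ℝ)) = Φ z) (k : ℤ) (z : ℂ) :
    gk Φ k (z + (Real.pi / 2 : ℝ)) = gk Φ k z := by
  unfold gk
  rw [hper]
  congr 1
  rw [show -(4 * (k : ℂ) * (z + (Real.pi / 2 : ℝ)) * I) =
      -(4 * (k : ℂ) * z * I) + -(4 * (k : ℂ) * (Real.pi / 2 : ℝ) * I) by ring,
    Complex.exp_add, exp_neg_four_k_half_pi, mul_one]

/-- `‖g_k(x + iy)‖ = e^{4ky} ‖Φ(x+iy)‖`. -/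
theorem norm_gk (Φ : ℂ → ℂ) (k : ℤ) (x y : ℝ) :
    ‖gk Φ k (x + y * I)‖ = Real.exp (4 * k * y) * ‖Φ (x + y * I)‖ := by
  unfold gk
  rw [norm_mul, Complex.norm_exp]
  congr 2
  simp only [neg_re, mul_re, mul_im, add_re, add_im, ofReal_re, ofReal_im, I_re, I_im, mul_zero, mul_one,
    zero_add, add_zero, sub_zero, zero_sub, Complex.re_ofNat, Complex.im_ofNat, Complex.intCast_re,
    Complex.intCast_im, zero_mul, mul_zero, sub_self]
  ring

/-- The strip integral `A_k = ∫₀^{π/2} g_k` is bounded by `(π/2)·C·e^{N|y|+4ky}` for every real `y`. -/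
theorem norm_Ak_le {Φ : ℂ → ℂ} {C N : ℝ} (hΦ : Differentiable ℂ Φ)
    (hper : ∀ z : ℂ, Φ (z + (Real.pi / 2 : ℝ)) = Φ z) (hbd : ∀ z : ℂ, ‖Φ z‖ ≤ C * Real.exp (N * |z.im|))
    (k : ℤ) (y : ℝ) :
    ‖∫ x in (0 : ℝ)..(Real.pi / 2 : ℝ), gk Φ k x‖ ≤
      Real.exp (4 * k * y) * (C * Real.exp (N * |y|)) * |(Real.pi / 2 : ℝ) - 0| := by
  rw [← integral_shift_eq (gk Φ k) (gk_differentiable hΦ k) (Real.pi / 2) (gk_periodic hper k) y]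
  refine intervalIntegral.norm_integral_le_of_norm_le_const fun x _ => ?_
  rw [norm_gk]
  refine mul_le_mul_of_nonneg_left ?_ (Real.exp_pos _).le
  have := hbd (x + y * I)
  simpa using this

/-- Vanishing of the strip integral for `4k > N`. -/
theorem Ak_eq_zero_of_pos {Φ : ℂ → ℂ} {C N : ℝ} (hΦ : Differentiable ℂ Φ)
    (hper : ∀ z : ℂ, Φ (z + (Real.pi / 2 : ℝ)) = Φ z) (hbd : ∀ z : ℂ, ‖Φ z‖ ≤ C * Real.exp (N * |z.im|))
    (k : ℤ) (hk : N < 4 * (k : ℝ)) : ∫ x in (0 : ℝ)..(Real.pi / 2 : ℝ), gk Φ k x = 0 := by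
  set A := ∫ x in (0 : ℝ)..(Real.pi / 2 : ℝ), gk Φ k x
  set a : ℝ := 4 * k - N with ha
  have ha0 : 0 < a := by linarith
  -- bound along y = -R
  have hbound : ∀ R : ℝ, 0 ≤ R → ‖A‖ ≤ C * |(Real.pi / 2 : ℝ) - 0| * Real.exp (-(a * R)) := by
    intro R hR
    have h := norm_Ak_le hΦ hper hbd k (-R)
    have hexp : Real.exp (4 * k * (-R)) * (C * Real.exp (N * |(-R)|)) * |(Real.pi / 2 : ℝ) - 0| =
        C * |(Real.pi / 2 : ℝ) - 0| * Real.exp (-(a * R)) := by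
      rw [abs_neg, abs_of_nonneg hR]
      have : Real.exp (4 * ↑k * -R) * Real.exp (N * R) = Real.exp (-(a * R)) := by
        rw [← Real.exp_add]; congr 1; rw [ha]; ring
      calc Real.exp (4 * ↑k * -R) * (C * Real.exp (N * R)) * |(Real.pi / 2 : ℝ) - 0|
          = C * |(Real.pi / 2 : ℝ) - 0| * (Real.exp (4 * ↑k * -R) * Real.exp (N * R)) := by ring
        _ = C * |(Real.pi / 2 : ℝ) - 0| * Real.exp (-(a * R)) := by rw [this]
    rw [hexp] at h
    exact h
  have htend : Tendsto (fun R : ℝ => C * |(Real.pi / 2 : ℝ) - 0| * Real.exp (-(a * R))) atTop (𝓝 0) := by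
    have h1 : Tendsto (fun R : ℝ => Real.exp (-(a * R))) atTop (𝓝 0) :=
      Real.tendsto_exp_neg_atTop_nhds_zero.comp (tendsto_id.const_mul_atTop ha0)
    simpa using h1.const_mul (C * |(Real.pi / 2 : ℝ) - 0|)
  have hle : ‖A‖ ≤ 0 :=
    ge_of_tendsto htend (Filter.eventually_atTop.2 ⟨0, fun R hR => hbound R hR⟩)
  exact norm_le_zero_iff.1 hle

/-- Vanishing of the strip integral for `4k < -N`. -/
theorem Ak_eq_zero_of_neg {Φ : ℂ → ℂ} {C N : ℝ} (hΦ : Differentiable ℂ Φ)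
    (hper : ∀ z : ℂ, Φ (z + (Real.pi / 2 : ℝ)) = Φ z) (hbd : ∀ z : ℂ, ‖Φ z‖ ≤ C * Real.exp (N * |z.im|))
    (k : ℤ) (hk : N < -(4 * (k : ℝ))) : ∫ x in (0 : ℝ)..(Real.pi / 2 : ℝ), gk Φ k x = 0 := by
  set A := ∫ x in (0 : ℝ)..(Real.pi / 2 : ℝ), gk Φ k x
  set a : ℝ := -(4 * k) - N with ha
  have ha0 : 0 < a := by linarith
  have hbound : ∀ R : ℝ, 0 ≤ R → ‖A‖ ≤ C * |(Real.pi / 2 : ℝ) - 0| * Real.exp (-(a * R)) := by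
    intro R hR
    have h := norm_Ak_le hΦ hper hbd k R
    have hexp : Real.exp (4 * k * R) * (C * Real.exp (N * |R|)) * |(Real.pi / 2 : ℝ) - 0| =
        C * |(Real.pi / 2 : ℝ) - 0| * Real.exp (-(a * R)) := by
      rw [abs_of_nonneg hR]
      have : Real.exp (4 * ↑k * R) * Real.exp (N * R) = Real.exp (-(a * R)) := by
        rw [← Real.exp_add]; congr 1; rw [ha]; ring
      calc Real.exp (4 * ↑k * R) * (C * Real.exp (N * R)) * |(Real.pi / 2 : ℝ) - 0|
          = C * |(Real.pi / 2 : ℝ) - 0| * (Real.exp (4 * ↑k * R) * Real.exp (N * R)) := by ring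
        _ = C * |(Real.pi / 2 : ℝ) - 0| * Real.exp (-(a * R)) := by rw [this]
    rw [hexp] at h
    exact h
  have htend : Tendsto (fun R : ℝ => C * |(Real.pi / 2 : ℝ) - 0| * Real.exp (-(a * R))) atTop (𝓝 0) := by
    have h1 : Tendsto (fun R : ℝ => Real.exp (-(a * R))) atTop (𝓝 0) :=
      Real.tendsto_exp_neg_atTop_nhds_zero.comp (tendsto_id.const_mul_atTop ha0)
    simpa using h1.const_mul (C * |(Real.pi / 2 : ℝ) - 0|)
  have hle : ‖A‖ ≤ 0 :=
    ge_of_tendsto htend (Filter.eventually_atTop.2 ⟨0, fun R hR => hbound R hR⟩)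
  exact norm_le_zero_iff.1 hle

/-- `0 < π/2` as a `Fact`, for Mathlib's Fourier theory on `AddCircle (π/2)`. -/
theorem fact_half_pi_pos : Fact (0 < (Real.pi / 2 : ℝ)) := ⟨by positivity⟩

attribute [local instance] fact_half_pi_pos

/-- The real restriction of `Φ` is `π/2`-periodic. -/
theorem periodic_restr {Φ : ℂ → ℂ} (hper : ∀ z : ℂ, Φ (z + (Real.pi / 2 : ℝ)) = Φ z) :
    Function.Periodic (fun x : ℝ => Φ x) (Real.pi / 2 : ℝ) := by
  intro x
  show Φ (((x + (Real.pi / 2 : ℝ) : ℝ)) : ℂ) = Φ (x : ℂ)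
  rw [Complex.ofReal_add]
  exact hper x

/-- Continuity of the lift to the circle. -/
theorem continuous_lift_restr {Φ : ℂ → ℂ} (hΦ : Differentiable ℂ Φ)
    (hper : ∀ z : ℂ, Φ (z + (Real.pi / 2 : ℝ)) = Φ z) :
    Continuous ((periodic_restr hper).lift : AddCircle (Real.pi / 2 : ℝ) → ℂ) := by
  have h : ((periodic_restr hper).lift : AddCircle (Real.pi / 2 : ℝ) → ℂ) ∘
      (QuotientAddGroup.mk : ℝ → AddCircle (Real.pi / 2 : ℝ)) = fun x : ℝ => Φ x := by
    funext x; exact (periodic_restr hper).lift_coe x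
  rw [(QuotientAddGroup.isQuotientMap_mk _).continuous_iff, h]
  exact hΦ.continuous.comp Complex.continuous_ofReal

/-- The lift as a bundled continuous map. -/
def liftC (Φ : ℂ → ℂ) (hΦ : Differentiable ℂ Φ) (hper : ∀ z : ℂ, Φ (z + (Real.pi / 2 : ℝ)) = Φ z) :
    C(AddCircle (Real.pi / 2 : ℝ), ℂ) :=
  ⟨(periodic_restr hper).lift, continuous_lift_restr hΦ hper⟩

theorem liftC_coe {Φ : ℂ → ℂ} (hΦ : Differentiable ℂ Φ) (hper : ∀ z : ℂ, Φ (z + (Real.pi / 2 : ℝ)) = Φ z)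
    (x : ℝ) : liftC Φ hΦ hper (x : AddCircle (Real.pi / 2 : ℝ)) = Φ x :=
  (periodic_restr hper).lift_coe x

/-- The characters of `AddCircle (π/2)` are `e^{4ikθ}`. -/
theorem fourier_coe_half_pi (k : ℤ) (θ : ℝ) :
    fourier k (θ : AddCircle (Real.pi / 2 : ℝ)) = Complex.exp (4 * (k : ℂ) * (θ : ℂ) * I) := by
  rw [fourier_coe_apply]
  congr 1
  push_cast
  have hπ : (Real.pi : ℂ) ≠ 0 := by exact_mod_cast Real.pi_ne_zero
  field_simp
  ring

/-- The Fourier coefficients of the lift are the strip integrals `(2/π) ∫₀^{π/2} g_k`. -/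
theorem fourierCoeff_liftC {Φ : ℂ → ℂ} (hΦ : Differentiable ℂ Φ)
    (hper : ∀ z : ℂ, Φ (z + (Real.pi / 2 : ℝ)) = Φ z) (k : ℤ) :
    fourierCoeff (liftC Φ hΦ hper) k = (1 / (Real.pi / 2 : ℝ)) • ∫ x in (0 : ℝ)..(Real.pi / 2 : ℝ), gk Φ k x := by
  rw [fourierCoeff_eq_intervalIntegral (liftC Φ hΦ hper) k 0, zero_add]
  congr 1
  refine intervalIntegral.integral_congr fun x _ => ?_
  show fourier (-k) (x : AddCircle (Real.pi / 2 : ℝ)) • liftC Φ hΦ hper (x : AddCircle (Real.pi / 2 : ℝ)) =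
    gk Φ k x
  rw [liftC_coe, fourier_coe_half_pi, smul_eq_mul, gk]
  congr 1
  congr 1
  push_cast
  ring

/-- The Fourier coefficients vanish off `[-K, K]` when `N < 4(K+1)`. -/
theorem fourierCoeff_liftC_eq_zero {Φ : ℂ → ℂ} {C N : ℝ} {K : ℕ} (hΦ : Differentiable ℂ Φ)
    (hper : ∀ z : ℂ, Φ (z + (Real.pi / 2 : ℝ)) = Φ z) (hbd : ∀ z : ℂ, ‖Φ z‖ ≤ C * Real.exp (N * |z.im|))
    (hN : N < 4 * ((K : ℝ) + 1)) (k : ℤ) (hk : k ∉ Finset.Icc (-(K : ℤ)) K) :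
    fourierCoeff (liftC Φ hΦ hper) k = 0 := by
  rw [Finset.mem_Icc, not_and_or, not_le, not_le] at hk
  rw [fourierCoeff_liftC]
  rcases hk with hk | hk
  · have hk' : (k : ℝ) ≤ -((K : ℝ) + 1) := by
      have : k ≤ -((K : ℤ) + 1) := by omega
      exact_mod_cast this
    rw [Ak_eq_zero_of_neg hΦ hper hbd k (by linarith), smul_zero]
  · have hk' : ((K : ℝ) + 1) ≤ (k : ℝ) := by
      have : (K : ℤ) + 1 ≤ k := by omega
      exact_mod_cast this
    rw [Ak_eq_zero_of_pos hΦ hper hbd k (by linarith), smul_zero]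

/-- **Angular Paley–Wiener** (= `stub_bandlimit` of line `complex-rotation-bandlimit`, verbatim statement). -/
theorem stub_bandlimit_proof :
    ∀ (Φ : ℂ → ℂ) (C N : ℝ) (K : ℕ), Differentiable ℂ Φ →
      (∀ z : ℂ, Φ (z + (Real.pi / 2 : ℝ)) = Φ z) →
      (∀ z : ℂ, ‖Φ z‖ ≤ C * Real.exp (N * |z.im|)) →
      N < 4 * ((K : ℝ) + 1) →
      ∃ c : ℤ → ℂ, ∀ θ : ℝ,
        Φ θ = ∑ k ∈ Finset.Icc (-(K : ℤ)) K, c k * Complex.exp (4 * (k : ℂ) * (θ : ℂ) * Complex.I) := by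
  intro Φ C N K hΦ hper hbd hN
  refine ⟨fun k => fourierCoeff (liftC Φ hΦ hper) k, fun θ => ?_⟩
  have hvan : ∀ k ∉ Finset.Icc (-(K : ℤ)) K, fourierCoeff (liftC Φ hΦ hper) k = 0 :=
    fun k hk => fourierCoeff_liftC_eq_zero hΦ hper hbd hN k hk
  have hcs : Summable (fourierCoeff (liftC Φ hΦ hper)) := summable_of_ne_finset_zero hvan
  have hzero : ∀ k ∉ Finset.Icc (-(K : ℤ)) K,
      fourierCoeff (liftC Φ hΦ hper) k • fourier k (θ : AddCircle (Real.pi / 2 : ℝ)) = 0 := by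
    intro k hk
    rw [hvan k hk, zero_smul]
  have hfin : HasSum (fun k : ℤ => fourierCoeff (liftC Φ hΦ hper) k • fourier k (θ : AddCircle (Real.pi / 2 : ℝ)))
      (∑ k ∈ Finset.Icc (-(K : ℤ)) K,
        fourierCoeff (liftC Φ hΦ hper) k • fourier k (θ : AddCircle (Real.pi / 2 : ℝ))) :=
    hasSum_sum_of_ne_finset_zero hzero
  have hsum := has_pointwise_sum_fourier_series_of_summable hcs (θ : AddCircle (Real.pi / 2 : ℝ))
  rw [liftC_coe] at hsum
  rw [hsum.unique hfin]
  refine Finset.sum_congr rfl fun k _ => ?_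
  rw [fourier_coe_half_pi, smul_eq_mul]

end AngularPaleyWiener

end
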